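import Mathlib
import Summits.MatrixMultiplication.MatrixMultiplication.Theses.FidelityWitnesses
import Summits.MatrixMultiplication.MatrixMultiplication.Theorems.BorderRankLowerBoundAssembly
import Summits.MatrixMultiplication.MatrixMultiplication.Theorems.FidelityGapThreeSeventeen.Negative.BorderRankReduction

/-!
# `FidelityWitnesses.Assembly` (stmt-MatrixMultiplication-4966) — proved

The assembly item of route `MatrixMultiplication/FidelityWitnesses` is the implication
`FidelityThesis → ¬ MatrixMultiplication`: a uniform fidelity gap `ε(n, r) > 0` against every
rank-`≤ r` tensor `S`, for all `n ≥ 1` and all `r ≤ c·n^{2+δ}`, refutes `ω(ℂ) = 2`.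

Proof (self-contained; it does not lean on the route file's deciding theorem `closes`, whose
argument it follows).
* the `0/1` tensor `⟨n,n,n⟩` has exactly `n³` ones, `Σ_{a,b,c} ⟨n,n,n⟩_{abc} = n³` — the tree lemma
  `fidelityGapThree_sum_matMulTensor` (`Theorems/FidelityGapThreeSeventeen/Negative/BorderRankReduction`,
  stated for every `n`), reused rather than re-declared.
* `fidelityWitnesses_superquadratic_rank_of_fidelityThesis`: fix `n ≥ 1` and put `r := R(⟨n,n,n⟩)`;
  if `r ≤ c·n^{2+δ}` the gap at `(n, r)` applied to `S := ⟨n,n,n⟩` itself (rank `r`, self-overlap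
  `n³`, squared norm `n³`) reads `n⁶ ≤ (1 − ε)·n³·n³`, absurd; hence `c·n^{2+δ} ≤ R(⟨n,n,n⟩)` for
  every `n ≥ 1` — a superquadratic RANK lower bound.
* `fidelityWitnesses_assembly_proof`: compose with the proved assembly of route
  `BorderRankLowerBound`, `Literature.not_matrixMultiplication_of_superquadratic_rank`
  (`Theorems/BorderRankLowerBoundAssembly.lean`: every admissible exponent is `≥ 2 + δ`, so
  `ω(ℂ) ≥ 2 + δ > 2`).
-/

namespace Summit.MatrixMultiplication.MatrixMultiplication.Theorems

open scoped BigOperators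
open Literature.Computability.AlgebraicComplexity

/-- **Fidelity thesis ⇒ superquadratic rank.** If `FidelityThesis` holds with parameters `δ, c`,
then `c·n^{2+δ} ≤ R(⟨n,n,n⟩)` for every `n ≥ 1`: otherwise `r := R(⟨n,n,n⟩) ≤ c·n^{2+δ}` and the
fidelity gap at `(n, r)` tested on `S := ⟨n,n,n⟩` itself (rank `≤ r`, `Σ S·⟨n,n,n⟩ = Σ ‖S‖² = n³`)
gives `n⁶ ≤ (1 − ε)·n⁶` with `ε > 0`, `n ≥ 1`. [folklore] -/
theorem fidelityWitnesses_superquadratic_rank_of_fidelityThesis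
    (h : Summit.MatrixMultiplication.MatrixMultiplication.Theses.FidelityWitnesses.FidelityThesis) :
    ∃ δ : ℝ, 0 < δ ∧ ∃ c : ℝ, 0 < c ∧ ∀ n : ℕ, 1 ≤ n →
      c * (n : ℝ) ^ (2 + δ) ≤ (tensorRank (matMulTensor ℂ n n n) : ℝ) := by
  obtain ⟨δ, hδ, c, hc, hgap⟩ := h
  refine ⟨δ, hδ, c, hc, fun n hn => ?_⟩
  by_contra hlt
  rw [not_le] at hlt
  obtain ⟨ε, hε, hS⟩ := hgap n (tensorRank (matMulTensor ℂ n n n)) hn hlt.le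
  have key := hS (matMulTensor ℂ n n n) le_rfl
  have hTT : ∀ a b c : Fin n × Fin n,
      matMulTensor ℂ n n n a b c * matMulTensor ℂ n n n a b c = matMulTensor ℂ n n n a b c := by
    intro a b c
    simp only [matMulTensor]
    split_ifs <;> simp
  have hNN : ∀ a b c : Fin n × Fin n,
      ‖matMulTensor ℂ n n n a b c‖ ^ 2 = matMulTensor ℝ n n n a b c := by
    intro a b c
    simp only [matMulTensor]
    split_ifs <;> simp
  simp_rw [hTT, hNN, fidelityGapThree_sum_matMulTensor] at key
  have hn3 : ‖((n : ℂ)) ^ 3‖ ^ 2 = ((n : ℝ) ^ 3) * ((n : ℝ) ^ 3) := by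
    rw [norm_pow, Complex.norm_natCast]
    ring
  rw [hn3] at key
  have hpos : (0 : ℝ) < (n : ℝ) ^ 3 * (n : ℝ) ^ 3 := by positivity
  nlinarith

/-- **Assembly of route `FidelityWitnesses` (stmt-MatrixMultiplication-4966), exact signature
`FidelityThesis → ¬ MatrixMultiplication`.** A uniform fidelity gap along a superquadratic curve
`r ≤ c·n^{2+δ}` yields the superquadratic rank lower bound `c·n^{2+δ} ≤ R(⟨n,n,n⟩)` (`n ≥ 1`,
`fidelityWitnesses_superquadratic_rank_of_fidelityThesis`), and such a bound refutes `ω(ℂ) = 2` by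
the proved assembly of route `BorderRankLowerBound`
(`Literature.not_matrixMultiplication_of_superquadratic_rank`). [folklore] -/
theorem fidelityWitnesses_assembly_proof :
    Summit.MatrixMultiplication.MatrixMultiplication.Theses.FidelityWitnesses.Assembly := by
  unfold Summit.MatrixMultiplication.MatrixMultiplication.Theses.FidelityWitnesses.Assembly
  intro h
  exact Literature.not_matrixMultiplication_of_superquadratic_rank
    (fidelityWitnesses_superquadratic_rank_of_fidelityThesis h)

end Summit.MatrixMultiplication.MatrixMultiplication.Theorems
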